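import Literature.NumberTheory.LFunctions.TruncatedWeilFormTailOrderDensityProofs
import Literature.NumberTheory.LFunctions.TruncatedWeilFormTailMinorsProofs
import HarnessLib

/-!
# RH-FREE — «nothing here bears on the truth of RH»: existence of `Q_arch,∞` from the tail representation (Groskin 2026, arXiv:2607.02828, Lemma 2.1 ⇐ Theorem 3.2 clause 1)

PROOF LAYER (theorems only, 0 defs / 0 named facts) for
`Literature/NumberTheory/LFunctions/TruncatedWeilFormTailOrder.lean` (statement file of cell
`rh-columns/lit`; written by seat rh-crit-cc-t6 under cc-lead ruling R156 (b); bears_on LADDER-RH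
W-C/W-P = COLUMN 2 WEIL, fleet debt). A DOOR, debt-neutral: `lemma_2_1_limit_of_repr` derives the claim
`Groskin2026.lemma_2_1_limit` (A. Groskin, arXiv:2607.02828v3, Lemma 2.1, p. 4: "the limit defining
`Q_arch,∞` exists entrywise") from the first clause of `Groskin2026.theorem_3_2` (the rank-two density
representation `Δ_{T₁,T₂}(m,n) = (1/π²)∫_{T₁}^{T₂} h₊(T) sin²(LT/2) ρ⁻¹ (p_T(m)p_T(n) + q_T(m)q_T(n)) dT`,
p. 10), taken as a hypothesis in exactly its typed form (the same `h1` as the tree's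
`theorem_3_2_of_repr`, `TruncatedWeilFormTailMinorsProofs.lean`).

Route: for `T₀ = max(2ρN, 7) + 1` and `T > T₀` the representation gives
`(Q_arch,T)_{mn} = (Q_arch,T₀)_{mn} + (1/π²)∫_{T₀}^{T} dens`; the density is continuous on `(T₀, ∞)`
(`continuous_hPlus`; no node `±ρk` there) and dominated by `16ρ T^{-3/2}`
(`0 < h₊(T) ≤ log T − 8/5 < 2√T` from `TruncatedWeilFormTailOrderDensityProofs`, `|p_T(k)|, |q_T(k)| ≤ 2ρ/T`),
hence integrable on `(T₀, ∞)`, so the partial integrals converge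
(`MeasureTheory.intervalIntegral_tendsto_integral_Ioi`) and `limUnder` is that limit
(`tendsto_nhds_limUnder`). The source is an unrefereed preprint ([claim: Groskin2026, status:
under-review]); nothing here bears on Weil positivity or on the truth of RH.
-/

noncomputable section

open Filter Set MeasureTheory Topology
open scoped Real

namespace Literature.NumberTheory.LFunctions.Groskin2026

/-- The integrand of the tail representation is dominated: for `T ≥ 2ρN`, `T ≥ 7`,
`|h₊(T) sin²(LT/2) ρ⁻¹ (p_T(m)p_T(n) + q_T(m)q_T(n))| ≤ 16 ρ T^{-3/2}` (`0 < h₊(T) ≤ log T ≤ 2√T` by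
`hPlus_pos_of_seven_le` / `hPlus_le_log_sub`, `|p_T(k)|, |q_T(k)| ≤ 2ρ/T` since `|ρk| ≤ ρN ≤ T/2`).
[cite: Groskin2026, Lemma 2.1 (p. 4) with Theorem 3.2 (p. 10) and Lemma 3.1 (p. 9)] -/
theorem abs_tailDensity_le {c : ℝ} (hc : 1 < c) (N : ℕ) (m n : idx N) {T : ℝ}
    (hT2 : 2 * (rho c * N) ≤ T) (hT7 : 7 ≤ T) :
    |hPlus T * Real.sin (Real.log c * T / 2) ^ 2 / rho c *
        (pVec c N T m * pVec c N T n + qVec c N T m * qVec c N T n)| ≤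
      16 * rho c * T ^ (-(3 / 2 : ℝ)) := by
  have hρ := rho_pos hc
  have hT0 : 0 < T := by linarith
  have hρN : 0 ≤ rho c * N := by positivity
  -- h₊ bound: 0 < h₊ T ≤ log T ≤ 2 √T
  have hh0 : 0 < hPlus T := hPlus_pos_of_seven_le hT7
  have hh1 : hPlus T ≤ Real.log T := by linarith [hPlus_le_log_sub hT7]
  have hlog : Real.log T ≤ 2 * T ^ (1 / 2 : ℝ) := by
    have := Real.log_le_rpow_div hT0.le (by norm_num : (0:ℝ) < 1 / 2)
    linarith
  -- node bounds: |T ± ρ k| ≥ T/2 for k ∈ I_N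
  have hnode : ∀ k : idx N, T / 2 ≤ T - rho c * ((k : ℤ) : ℝ) ∧ T / 2 ≤ T + rho c * ((k : ℤ) : ℝ) := by
    intro k
    have h := abs_rho_mul_le hc k
    constructor <;> [linarith [le_abs_self (rho c * ((k : ℤ) : ℝ))];
      linarith [neg_abs_le (rho c * ((k : ℤ) : ℝ))]]
  have hp : ∀ k : idx N, |pVec c N T k| ≤ 2 * rho c / T := by
    intro k
    rw [pVec_eq hc, abs_div, abs_of_pos hρ, abs_of_pos (by linarith [(hnode k).1])]
    rw [div_le_div_iff₀ (by linarith [(hnode k).1]) hT0]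
    nlinarith [(hnode k).1, hρ]
  have hq : ∀ k : idx N, |qVec c N T k| ≤ 2 * rho c / T := by
    intro k
    rw [qVec_eq hc, abs_div, abs_of_pos hρ, abs_of_pos (by linarith [(hnode k).2])]
    rw [div_le_div_iff₀ (by linarith [(hnode k).2]) hT0]
    nlinarith [(hnode k).2, hρ]
  have hpq : |pVec c N T m * pVec c N T n + qVec c N T m * qVec c N T n| ≤ 8 * rho c ^ 2 / T ^ 2 := by
    calc |pVec c N T m * pVec c N T n + qVec c N T m * qVec c N T n|
        ≤ |pVec c N T m| * |pVec c N T n| + |qVec c N T m| * |qVec c N T n| := by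
          rw [← abs_mul, ← abs_mul]; exact abs_add_le _ _
      _ ≤ (2 * rho c / T) * (2 * rho c / T) + (2 * rho c / T) * (2 * rho c / T) := by
          gcongr <;> first | exact abs_nonneg _ | exact hp _ | exact hq _
      _ = 8 * rho c ^ 2 / T ^ 2 := by field_simp; ring
  have hsin : Real.sin (Real.log c * T / 2) ^ 2 ≤ 1 := by
    rw [sq_le_one_iff_abs_le_one]; exact Real.abs_sin_le_one _
  -- assemble
  rw [abs_mul, abs_div, abs_mul, abs_of_pos hh0, abs_of_pos hρ,
    abs_of_nonneg (sq_nonneg _)]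
  have hsqrt : T ^ (-(3 / 2 : ℝ)) = T ^ (1 / 2 : ℝ) / T ^ 2 := by
    rw [show (-(3 / 2 : ℝ)) = (1 / 2 : ℝ) - 2 by norm_num, Real.rpow_sub hT0, Real.rpow_two]
  rw [hsqrt]
  have hA : 0 ≤ |pVec c N T m * pVec c N T n + qVec c N T m * qVec c N T n| := abs_nonneg _
  have h1 : hPlus T * Real.sin (Real.log c * T / 2) ^ 2 ≤ 2 * T ^ (1 / 2 : ℝ) * 1 :=
    mul_le_mul (hh1.trans hlog) hsin (sq_nonneg _) (by positivity)
  have h2 : hPlus T * Real.sin (Real.log c * T / 2) ^ 2 / rho c ≤ 2 * T ^ (1 / 2 : ℝ) * 1 / rho c :=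
    div_le_div_of_nonneg_right h1 hρ.le
  have h3 : 0 ≤ hPlus T * Real.sin (Real.log c * T / 2) ^ 2 / rho c := by positivity
  calc hPlus T * Real.sin (Real.log c * T / 2) ^ 2 / rho c *
        |pVec c N T m * pVec c N T n + qVec c N T m * qVec c N T n|
      ≤ (2 * T ^ (1 / 2 : ℝ) * 1 / rho c) * (8 * rho c ^ 2 / T ^ 2) :=
        mul_le_mul h2 hpq hA (by positivity)
    _ = 16 * rho c * (T ^ (1 / 2 : ℝ) / T ^ 2) := by field_simp; ring

/-- The tail density is continuous on `(T₀, ∞)` for `T₀ ≥ ρN` (no node `±ρk`, `k ∈ I_N`, lies there;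
`h₊` is continuous). [cite: Groskin2026, Theorem 3.2 (p. 10)] -/
theorem continuousOn_tailDensity {c : ℝ} (hc : 1 < c) (N : ℕ) (m n : idx N) {T₀ : ℝ}
    (hT₀ : rho c * N ≤ T₀) :
    ContinuousOn (fun T : ℝ ↦ hPlus T * Real.sin (Real.log c * T / 2) ^ 2 / rho c *
        (pVec c N T m * pVec c N T n + qVec c N T m * qVec c N T n)) (Ioi T₀) := by
  have hρ := rho_pos hc
  have hden : ∀ k : idx N, ∀ T ∈ Ioi T₀,
      T - rho c * ((k : ℤ) : ℝ) ≠ 0 ∧ T + rho c * ((k : ℤ) : ℝ) ≠ 0 := by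
    intro k T hT
    have h := abs_rho_mul_le hc k
    have hT' : T₀ < T := hT
    constructor
    · intro h0; linarith [le_abs_self (rho c * ((k : ℤ) : ℝ))]
    · intro h0; linarith [neg_abs_le (rho c * ((k : ℤ) : ℝ))]
  have hp : ∀ k : idx N, ContinuousOn (fun T : ℝ ↦ pVec c N T k) (Ioi T₀) := by
    intro k
    simp_rw [pVec_eq hc]
    exact continuousOn_const.div (by fun_prop) fun T hT ↦ (hden k T hT).1
  have hq : ∀ k : idx N, ContinuousOn (fun T : ℝ ↦ qVec c N T k) (Ioi T₀) := by
    intro k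
    simp_rw [qVec_eq hc]
    exact continuousOn_const.div (by fun_prop) fun T hT ↦ (hden k T hT).2
  have hh : ContinuousOn (fun T : ℝ ↦ hPlus T * Real.sin (Real.log c * T / 2) ^ 2 / rho c) (Ioi T₀) :=
    ((continuous_hPlus.mul (by fun_prop)).div_const _).continuousOn
  exact hh.mul (((hp m).mul (hp n)).add ((hq m).mul (hq n)))

/-- The tail density is integrable on `(T₀, ∞)` for `T₀ ≥ 2ρN`, `T₀ ≥ 7` (dominated by `16ρ T^{-3/2}`).
[cite: Groskin2026, Lemma 2.1 (p. 4) and Corollary 3.3 (p. 11, the tail budget `B_T` is finite)] -/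
theorem integrableOn_tailDensity {c : ℝ} (hc : 1 < c) (N : ℕ) (m n : idx N) {T₀ : ℝ}
    (hT₀ : 2 * (rho c * N) ≤ T₀) (hT₀7 : 7 ≤ T₀) :
    IntegrableOn (fun T : ℝ ↦ hPlus T * Real.sin (Real.log c * T / 2) ^ 2 / rho c *
        (pVec c N T m * pVec c N T n + qVec c N T m * qVec c N T n)) (Ioi T₀) := by
  have hρ := rho_pos hc
  have hT₀pos : 0 < T₀ := by linarith
  have hρN : rho c * N ≤ T₀ := by nlinarith [hρ, (Nat.cast_nonneg N : (0:ℝ) ≤ N)]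
  have hmaj : IntegrableOn (fun T : ℝ ↦ 16 * rho c * T ^ (-(3 / 2 : ℝ))) (Ioi T₀) :=
    ((integrableOn_Ioi_rpow_of_lt (by norm_num) hT₀pos).const_mul (16 * rho c))
  refine hmaj.mono' ((continuousOn_tailDensity hc N m n hρN).aestronglyMeasurable measurableSet_Ioi) ?_
  rw [ae_restrict_iff' measurableSet_Ioi]
  refine Filter.Eventually.of_forall fun T hT ↦ ?_
  rw [Real.norm_eq_abs]
  have hT' : T₀ < T := hT
  exact abs_tailDensity_le hc N m n (by linarith) (by linarith)

/-- **Door to [Gr26] Lemma 2.1, first clause** (`lemma_2_1_limit`): the rank-two density representation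
of the archimedean increments (Theorem 3.2, clause 1, taken as the hypothesis `h1` in exactly its typed
∀-closed form) implies that the entrywise limit `Q_arch,∞ = lim_{T→∞} Q_arch,T` exists — so that
`archMatrixInfty`, defined entrywise by `limUnder`, IS that limit: for `T > T₀ = max(2ρN, 7) + 1`,
`(Q_arch,T)_{mn} = (Q_arch,T₀)_{mn} + (1/π²)∫_{T₀}^{T} dens` with `dens` integrable on `(T₀, ∞)`
(`integrableOn_tailDensity`), hence convergent (`MeasureTheory.intervalIntegral_tendsto_integral_Ioi`).
The closer `lemma_2_1_limit_holds := lemma_2_1_limit_of_repr <clause 1>` is one line once clause 1 lands.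
[cite: Groskin2026, Lemma 2.1 (p. 4) with Theorem 3.2 (p. 10)] -/
theorem lemma_2_1_limit_of_repr
    (h1 : ∀ (c : ℝ), 1 < c → ∀ (N : ℕ) (T₁ T₂ : ℝ), max (rho c * N) 7 < T₁ → T₁ < T₂ →
      ∀ m n : idx N, (archMatrix c N T₂ - archMatrix c N T₁) m n =
        (1 / π ^ 2) * ∫ T in T₁..T₂, hPlus T * Real.sin (Real.log c * T / 2) ^ 2 / rho c *
          (pVec c N T m * pVec c N T n + qVec c N T m * qVec c N T n)) :
    lemma_2_1_limit := by
  intro c hc N m n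
  have hρ := rho_pos hc
  set T₀ : ℝ := max (2 * (rho c * N)) 7 + 1 with hT₀
  have hT₀a : 2 * (rho c * N) ≤ T₀ := by linarith [le_max_left (2 * (rho c * N)) 7]
  have hT₀b : 7 ≤ T₀ := by linarith [le_max_right (2 * (rho c * N)) 7]
  have hT₀c : max (rho c * N) 7 < T₀ := by
    have : rho c * N ≤ 2 * (rho c * N) := by nlinarith [hρ, (Nat.cast_nonneg N : (0:ℝ) ≤ N)]
    rcases le_total (rho c * N) 7 with h | h
    · rw [max_eq_right h]; linarith [le_max_right (2 * (rho c * N)) 7]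
    · rw [max_eq_left h]; linarith [le_max_left (2 * (rho c * N)) 7]
  set dens : ℝ → ℝ := fun T ↦ hPlus T * Real.sin (Real.log c * T / 2) ^ 2 / rho c *
    (pVec c N T m * pVec c N T n + qVec c N T m * qVec c N T n) with hdens
  have hint : IntegrableOn dens (Ioi T₀) := integrableOn_tailDensity hc N m n hT₀a hT₀b
  -- the limit of the partial integrals
  have hF : Tendsto (fun T : ℝ ↦ archMatrix c N T₀ m n + 1 / π ^ 2 * ∫ x in T₀..T, dens x) atTop
      (𝓝 (archMatrix c N T₀ m n + 1 / π ^ 2 * ∫ x in Ioi T₀, dens x)) :=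
    ((MeasureTheory.intervalIntegral_tendsto_integral_Ioi T₀ hint tendsto_id).const_mul _).const_add _
  have heq : (fun T : ℝ ↦ archMatrix c N T₀ m n + 1 / π ^ 2 * ∫ x in T₀..T, dens x) =ᶠ[atTop]
      (fun T : ℝ ↦ archMatrix c N T m n) := by
    filter_upwards [eventually_gt_atTop T₀] with T hT
    have h := h1 c hc N T₀ T hT₀c hT m n
    rw [Matrix.sub_apply] at h
    rw [hdens]
    linarith
  have hlim : Tendsto (fun T : ℝ ↦ archMatrix c N T m n) atTop
      (𝓝 (archMatrix c N T₀ m n + 1 / π ^ 2 * ∫ x in Ioi T₀, dens x)) := hF.congr' heq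
  have : archMatrixInfty c N m n = limUnder atTop (fun T : ℝ ↦ archMatrix c N T m n) := by
    unfold archMatrixInfty; rw [Matrix.of_apply]
  rw [this]
  exact tendsto_nhds_limUnder ⟨_, hlim⟩

end Literature.NumberTheory.LFunctions.Groskin2026

end
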